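import Summits.CriticalPhenomena.Ising3DConformalLimit.Theorems.LogPolarProxyExistsContinuousLimitLimitContinuity
import Summits.CriticalPhenomena.Ising3DConformalLimit.Theorems.HyperoctahedralRPExistsScaleCovariantLimitFoldedCurrentUniqueness
import HarnessLib

/-!
# Crux `ExistsContinuousLimit` (item stmt-CriticalPhenomena-4582) IS item 6150 ∧ item 4659 — by-name split

Routes `LogPolarProxy` / `ReflectionTwin` (sub-problem `CriticalPhenomena/Ising3DConformalLimit`), shared crux
`Summit.CriticalPhenomena.Ising3DConformalLimit.Theses.LogPolarProxy.ExistsContinuousLimit` (item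
stmt-CriticalPhenomena-4582; the `ReflectionTwin` copy is the same term). Line `birth` (lead continuation c1).

The crux is the OPEN existence problem of the critical `ℤ³` Ising spin scaling limit (H. Duminil-Copin, ICM 2022,
§8.4) plus a continuity clause. Nothing here proves it. This file lands, kernel-checked, the composite of two
reductions already in the tree, so that the ledger sees the crux's exact debt BY NAME:

* `LogPolarProxyExistsContinuousLimit.existsContinuousLimit_iff_existsScaleCovariantLimit` (p146967): the crux ⟺
  item stmt-CriticalPhenomena-1981 `HyperoctahedralRP.ExistsScaleCovariantLimit` (continuity of any full-filter
  limit is automatic: mesh continuity + free translation invariance);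
* `FoldedCurrentRepulsion.crux_iff_doubling_and_totallyDisconnected` (p139907): item 1981 ⟺ item
  stmt-CriticalPhenomena-6150 `MirrorHoelderCompactness.TwoPointDoubling` (all-scale doubling of the axial critical
  two-point function — the compactness half) ∧ item stmt-CriticalPhenomena-4659
  `ClusterRigidity.ClusterSetTotallyDisconnected` (the cluster set of the self-normalised family is totally
  disconnected — the uniqueness half).

Hence `existsContinuousLimit_iff_doubling_and_totallyDisconnected` : **crux 4582 ⟺ item 6150 ∧ item 4659**, with the
by-name handles in both directions and the `ReflectionTwin` copy. When items 6150 and 4659 close,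
`existsContinuousLimit_of_doubling_of_totallyDisconnected` IS the proof of the crux for both wanting routes.
-/

namespace Summit.CriticalPhenomena.Ising3DConformalLimit.LogPolarProxyExistsContinuousLimit

open Summit.CriticalPhenomena.Ising3DConformalLimit.Theses
open Summit.CriticalPhenomena.Ising3DConformalLimit.Cruxes.ExistsScaleCovariantLimit.FoldedCurrentRepulsion
  (crux_iff_doubling_and_totallyDisconnected)

/-- **Crux 4582 ⟺ item 6150 ∧ item 4659.** `LogPolarProxy.ExistsContinuousLimit` holds iff the axial critical
two-point function on `ℤ³` doubles at all scales (`MirrorHoelderCompactness.TwoPointDoubling`, item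
stmt-CriticalPhenomena-6150) and the cluster set of the self-normalised critical correlators is totally disconnected
(`ClusterRigidity.ClusterSetTotallyDisconnected`, item stmt-CriticalPhenomena-4659): the composite of
`existsContinuousLimit_iff_existsScaleCovariantLimit` (p146967) and
`FoldedCurrentRepulsion.crux_iff_doubling_and_totallyDisconnected` (p139907). [folklore] -/
theorem existsContinuousLimit_iff_doubling_and_totallyDisconnected :
    Summit.CriticalPhenomena.Ising3DConformalLimit.Theses.LogPolarProxy.ExistsContinuousLimit ↔
      Summit.CriticalPhenomena.Ising3DConformalLimit.Theses.MirrorHoelderCompactness.TwoPointDoubling ∧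
        Summit.CriticalPhenomena.Ising3DConformalLimit.Theses.ClusterRigidity.ClusterSetTotallyDisconnected :=
  existsContinuousLimit_iff_existsScaleCovariantLimit.trans crux_iff_doubling_and_totallyDisconnected

/-- **Item 6150 ∧ item 4659 ⟹ crux 4582** (the closing direction, by name): all-scale doubling of the axial critical
two-point function and total disconnectedness of the cluster set give the continuous, normalised, non-degenerate,
translation-invariant, scale-covariant full scaling limit of the critical `ℤ³` Ising correlators. [folklore] -/
theorem existsContinuousLimit_of_doubling_of_totallyDisconnected
    (hD : MirrorHoelderCompactness.TwoPointDoubling)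
    (hT : ClusterRigidity.ClusterSetTotallyDisconnected) :
    LogPolarProxy.ExistsContinuousLimit :=
  existsContinuousLimit_iff_doubling_and_totallyDisconnected.2 ⟨hD, hT⟩

/-- **Crux 4582 ⟹ item 6150**: a continuous scale-covariant full scaling limit of the critical `ℤ³` Ising
correlators forces all-scale doubling of the axial two-point function. [folklore] -/
theorem twoPointDoubling_of_existsContinuousLimit (h : LogPolarProxy.ExistsContinuousLimit) :
    MirrorHoelderCompactness.TwoPointDoubling :=
  (existsContinuousLimit_iff_doubling_and_totallyDisconnected.1 h).1

/-- **Crux 4582 ⟹ item 4659**: a continuous scale-covariant full scaling limit of the critical `ℤ³` Ising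
correlators forces the cluster set of the self-normalised family to be totally disconnected (it is one point).
[folklore] -/
theorem clusterSetTotallyDisconnected_of_existsContinuousLimit (h : LogPolarProxy.ExistsContinuousLimit) :
    ClusterRigidity.ClusterSetTotallyDisconnected :=
  (existsContinuousLimit_iff_doubling_and_totallyDisconnected.1 h).2

/-- **The `ReflectionTwin` copy of the crux ⟺ item 6150 ∧ item 4659** (the two route decls are the same term).
[folklore] -/
theorem reflectionTwin_existsContinuousLimit_iff_doubling_and_totallyDisconnected :
    ReflectionTwin.ExistsContinuousLimit ↔
      MirrorHoelderCompactness.TwoPointDoubling ∧ ClusterRigidity.ClusterSetTotallyDisconnected :=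
  existsContinuousLimit_iff_doubling_and_totallyDisconnected

/-- **Item 6150 ∧ item 4659 ⟹ the `ReflectionTwin` copy of the crux** (by name). [folklore] -/
theorem reflectionTwin_existsContinuousLimit_of_doubling_of_totallyDisconnected
    (hD : MirrorHoelderCompactness.TwoPointDoubling)
    (hT : ClusterRigidity.ClusterSetTotallyDisconnected) :
    ReflectionTwin.ExistsContinuousLimit :=
  reflectionTwin_existsContinuousLimit_iff_doubling_and_totallyDisconnected.2 ⟨hD, hT⟩

end Summit.CriticalPhenomena.Ising3DConformalLimit.LogPolarProxyExistsContinuousLimit
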